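import Mathlib
import Summits.ResolutionOfSingularities.ResolutionOfSingularities.Theorems.RadicialJungCleanModelsCleanPointBlowupChart
import Literature.AlgebraicGeometry.Resolution.BlowupChartRsop
import HarnessLib

/-!
# Route `RadicialJung`, crux `CleanModels` (stmt-ResolutionOfSingularities-15917), line `Sketch` rev 18, stub 4e
# `stub_cleanPrincipalization3`: cleanness survives the blowing up of a CLEAN-PERMISSIBLE regular centre — chart algebra, I

Lens-5 g6 STUBPLAN §7 (L7a) / lead memo `Cruxes/CleanModels/Lines/Sketch-memo-open-stubs.md` §1 (i): the curve analogue of the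
landed closed-point survival lemma 4d (`stub_cleanPointBlowup`, ✓ p671162), dimension-free.  `R` is a regular local ring with a
regular system of parameters `(c, w)` (`c : Fin n → R` the CENTRE coordinates, `w : Fin l → R` the others, `Ideal.span (c, w) = 𝔪`,
`emb dim R = n + l`), and we are given ABSTRACT CHART DATA of the blowing up of `Spec R` along `I = (c)` in the `cᵢ`-chart, in the
format of `BlowupChartRsop.lean` (a Noetherian ring `A`, `ψ : R → A`, fractions `u_k` with `ψ(c_k) = ψ(cᵢ) u_k`, `ψ(cᵢ)` a
non-zero-divisor, `ε : (R/I)[T_k : k ≠ i] ≅ A/(ψ cᵢ)`, a prime `𝔓 ⊆ A` over `𝔪`, `L = A_𝔓` read in a field `F'` by an injective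
`f'`).  PROVED here:

* `looseCleanForm_twist_of_isRsopPart` — a unit times a monomial in PART of a regular system of parameters with SOME exponent prime
  to `p` is, up to a `p`-th power twist, loosely clean (form (1) in the coordinates with exponent prime to `p`);
* `exists_prime_comap_centreChartReduction` — the prime of the point on the exceptional chart `(R/I)[T]`;
* `looseCleanForm_centreChart_of_monomial` — **the permissible monomial form survives**: if `X = f'(ψ(u · ∏ c_k^{a_k} · ∏ w_m^{b_m}))`
  with `u` a unit and SOME exponent (`a_k` or `b_m`) prime to `p`, then `e^p X` is loosely clean at `L` for some `e ≠ 0`: in the chart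
  `ψ(∏ c_k^{a_k}) = ψ(cᵢ)^A ∏ u_k^{a_k}`, the charged fractions `u_k ∈ 𝔓` together with `ψ(cᵢ)` and the `ψ(w_m)` are part of a regular
  system of parameters of `L` (`isRsopPart_chartFamily`); if some surviving exponent is prime to `p` this is `looseCleanForm_twist…`;
  otherwise the unit `U = ψ(u) ∏_{u_k ∉ 𝔓} u_k^{a_k}` has `D Ū = a_{k₀} Ū ≠ 0` for the Euler derivation `T_{k₀} ∂/∂T_{k₀}` of the
  exceptional chart (`k₀ ≠ i` uncharged with `p ∤ a_{k₀}` exists by a residue count mod `p`) and the Leibniz obstruction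
  (`stub_leibnizObstruction`) makes it loosely clean (form (2) or (3)).

Form (2), the Rees chart and the scheme-level statement are in the sequel files.  Honest framing: OURS; one local-algebra lemma toward
the research stub 4e; nothing here proves resolution in characteristic `p` or any case of `CleanModels`.
-/

noncomputable section

set_option linter.dupNamespace false -- mandated namespace of this single-conjunct summit

open IsLocalRing MvPolynomial
open Literature.AlgebraicGeometry.Resolution

namespace Summit.ResolutionOfSingularities.ResolutionOfSingularities.Theorems.RadicialJung.CleanModels

universe u

/-! ## Twisting away `p`-th powers in a monomial -/

/-- **Form (1) up to a `p`-th power twist.**  If `z : Fin N → L` is part of a regular system of parameters of the local ring `L`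
(read in the field `F'` by an injective `f'`), `v` is a unit and SOME exponent `ex k` is prime to `p`, then
`e^p · f'(v ∏ z_k^{ex_k})` has loose clean form (1) for some `e ≠ 0` (twist away the coordinates whose exponent is a multiple of
`p`; keep the others). [folklore] -/
theorem looseCleanForm_twist_of_isRsopPart (p : ℕ) {L F' : Type*} [CommRing L] [IsLocalRing L] [Field F']
    (f' : L →+* F') (hf' : Function.Injective f') {N : ℕ} {z : Fin N → L} (hz : IsRsopPart z) (ex : Fin N → ℕ)
    (hex : ∃ k, ¬ p ∣ ex k) {v : L} (hv : IsUnit v) {Y : F'} (hY : Y = f' (v * ∏ k, z k ^ ex k)) :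
    ∃ e : F', e ≠ 0 ∧ LooseCleanForm p f' (e ^ p * Y) := by
  classical
  set P : Finset (Fin N) := Finset.univ.filter (fun k => ¬ p ∣ ex k) with hP
  -- the `p`-divisible part is a `p`-th power
  have hdiv : ∀ k ∈ Finset.univ.filter (fun k => p ∣ ex k), ex k = p * (ex k / p) := fun k hk =>
    (Nat.mul_div_cancel' (Finset.mem_filter.mp hk).2).symm
  set g : F' := ∏ k ∈ Finset.univ.filter (fun k => p ∣ ex k), f' (z k) ^ (ex k / p) with hg
  have hg0 : g ≠ 0 := by
    rw [hg]
    exact Finset.prod_ne_zero_iff.mpr fun k _ => pow_ne_zero _ ((map_ne_zero_iff f' hf').mpr (hz.ne_zero k))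
  have hsplit : f' (∏ k, z k ^ ex k) = g ^ p * ∏ k ∈ P, f' (z k) ^ ex k := by
    rw [map_prod, ← Finset.prod_filter_mul_prod_filter_not Finset.univ (fun k => p ∣ ex k)]
    simp only [map_pow]
    congr 1
    rw [hg, ← Finset.prod_pow]
    refine Finset.prod_congr rfl fun k hk => ?_
    rw [← pow_mul, mul_comm, ← hdiv k hk]
  -- enumerate `P`; the sub-family is still part of a regular system of parameters
  let emb : Fin P.card ↪o Fin N := P.orderEmbOfFin rfl
  have hembP : ∀ k, ¬ p ∣ ex (emb k) := fun k => (Finset.mem_filter.mp (P.orderEmbOfFin_mem rfl k)).2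
  have hzP : IsRsopPart (z ∘ emb) := hz.comp emb emb.injective
  have hn0 : 0 < P.card := by
    obtain ⟨k, hk⟩ := hex
    exact Finset.card_pos.mpr ⟨k, Finset.mem_filter.mpr ⟨Finset.mem_univ _, hk⟩⟩
  have hprodP : ∏ k ∈ P, f' (z k) ^ ex k = f' (∏ k : Fin P.card, (z ∘ emb) k ^ ex (emb k)) := by
    have hmap : (Finset.univ : Finset (Fin P.card)).map emb.toEmbedding = P := by
      apply Finset.coe_injective
      rw [Finset.coe_map, Finset.coe_univ, Set.image_univ]
      exact P.range_orderEmbOfFin rfl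
    rw [← Finset.prod_congr hmap (fun _ _ => rfl), Finset.prod_map, map_prod]
    simp only [map_pow]
    rfl
  refine ⟨g⁻¹, inv_ne_zero hg0, ?_⟩
  refine looseCleanForm_one_of_isRsopPart p f' hzP hn0 (fun k => ex (emb k)) hembP hv (Y := (g⁻¹) ^ p * Y) ?_
  rw [hY, map_mul, hsplit, map_mul, ← hprodP, inv_pow]
  field_simp

/-- In characteristic `p`, a natural number prime to `p` is a unit. [folklore] -/
theorem isUnit_natCast_of_not_dvd (p : ℕ) [hp : Fact p.Prime] {S : Type*} [CommRing S] [CharP S p] {m : ℕ}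
    (h : ¬ p ∣ m) : IsUnit (m : S) := by
  have h0 : (m : ZMod p) ≠ 0 := fun h0 => h ((CharP.cast_eq_zero_iff (ZMod p) p m).mp h0)
  have h1 := (isUnit_iff_ne_zero.mpr h0).map (ZMod.castHom (dvd_refl p) S)
  rwa [map_natCast] at h1

/-! ## Abstract chart data of the blowing up of a regular local ring along part of a regular system of parameters -/

section AbstractChart

variable {R : Type u} [CommRing R] [IsRegularLocalRing R] {n : ℕ} (c : Fin n → R) (i : Fin n) {l : ℕ} (w : Fin l → R)
  (hz : Ideal.span (Set.range (Fin.append c w)) = maximalIdeal R) (hd : (maximalIdeal R).spanFinrank = n + l)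
  {A : Type u} [CommRing A] (ψ : R →+* A) (uA : Fin n → A)
  (hrel : ∀ k, ψ (c k) = ψ (c i) * uA k) (hnzd : ψ (c i) ∈ nonZeroDivisors A)
  (ε : MvPolynomial {k : Fin n // k ≠ i} (R ⧸ Ideal.span (Set.range c)) ≃+* A ⧸ Ideal.span {ψ (c i)})
  (hεC : ∀ r : R, ε (C (Ideal.Quotient.mk (Ideal.span (Set.range c)) r)) = Ideal.Quotient.mk _ (ψ r))
  (hεX : ∀ k : {k : Fin n // k ≠ i}, ε (X k) = Ideal.Quotient.mk _ (uA k.1))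
  (𝔓 : Ideal A) [𝔓.IsPrime] (h𝔓 : 𝔓.comap ψ = maximalIdeal R)
  (L : Type u) [CommRing L] [IsLocalRing L] [Algebra A L] [IsLocalization.AtPrime L 𝔓]
  (p : ℕ) [hp : Fact p.Prime]

local notation3 "I" => Ideal.span (Set.range c)
local notation3 "P" => MvPolynomial {k : Fin n // k ≠ i} (R ⧸ Ideal.span (Set.range c))

include hrel hnzd in
omit [IsRegularLocalRing R] in
/-- `u_i = 1` (`ψ(cᵢ) = ψ(cᵢ) uᵢ` with `ψ(cᵢ)` a non-zero-divisor). [folklore] -/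
theorem centreChartFrac_self : uA i = 1 :=
  (mul_cancel_left_mem_nonZeroDivisors hnzd).mp (by rw [mul_one]; exact (hrel i).symm)

include hz hd in
/-- The centre ideal `I = (c)` is a proper ideal. [folklore] -/
theorem span_centre_ne_top : (I : Ideal R) ≠ ⊤ :=
  (isRsopPart_centre c w hz hd).span_range_ne_top

include hz hd in
/-- `R/I` has characteristic `p` if `R` has. [folklore] -/
theorem charP_quotient_span_centre [CharP R p] : CharP (R ⧸ I) p := by
  haveI := isDomain_of_isRegularLocalRing R
  haveI : Nontrivial (R ⧸ I) := Ideal.Quotient.nontrivial_iff.mpr (span_centre_ne_top c w hz hd)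
  exact CharP.of_ringHom_of_ne_zero (Ideal.Quotient.mk _) p hp.out.ne_zero

/-! ### The reduction map `A → A/(ψ cᵢ) ≅ (R/I)[T]` and the prime of the point on the exceptional chart -/

omit [IsRegularLocalRing R] in
/-- The reduction map `A → (R/I)[T_k : k ≠ i]` is surjective. [folklore] -/
theorem centreChartReduction_surjective :
    Function.Surjective (ε.symm.toRingHom.comp (Ideal.Quotient.mk (Ideal.span {ψ (c i)}))) :=
  ε.symm.surjective.comp Ideal.Quotient.mk_surjective

include hεC in
omit [IsRegularLocalRing R] in
/-- The reduction map on `ψ(r)` is the constant `r̄`. [folklore] -/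
theorem centreChartReduction_map (r : R) :
    (ε.symm.toRingHom.comp (Ideal.Quotient.mk (Ideal.span {ψ (c i)}))) (ψ r) =
      C (Ideal.Quotient.mk (Ideal.span (Set.range c)) r) := by
  rw [RingHom.comp_apply, RingEquiv.toRingHom_eq_coe, RingEquiv.coe_toRingHom, RingEquiv.symm_apply_eq, hεC]

include hεX in
omit [IsRegularLocalRing R] in
/-- The reduction map on the fraction `u_k` (`k ≠ i`) is the variable `T_k`. [folklore] -/
theorem centreChartReduction_frac (k : {k : Fin n // k ≠ i}) :
    (ε.symm.toRingHom.comp (Ideal.Quotient.mk (Ideal.span {ψ (c i)}))) (uA k.1) = X k := by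
  rw [RingHom.comp_apply, RingEquiv.toRingHom_eq_coe, RingEquiv.coe_toRingHom, RingEquiv.symm_apply_eq, hεX]

include hz h𝔓 in
omit [𝔓.IsPrime] in
/-- The kernel of the reduction map lies in `𝔓`. [folklore] -/
theorem ker_centreChartReduction_le :
    RingHom.ker (ε.symm.toRingHom.comp (Ideal.Quotient.mk (Ideal.span {ψ (c i)}))) ≤ 𝔓 := by
  intro x hx
  rw [RingHom.mem_ker, RingHom.comp_apply, RingEquiv.toRingHom_eq_coe, RingEquiv.coe_toRingHom,
    EmbeddingLike.map_eq_zero_iff, Ideal.Quotient.eq_zero_iff_mem, Ideal.mem_span_singleton] at hx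
  obtain ⟨y, rfl⟩ := hx
  exact 𝔓.mul_mem_right _ (map_centre_mem c w hz ψ 𝔓 h𝔓 i)

include hz h𝔓 in
/-- **The prime of the point on the exceptional chart**: a prime `Q` of `(R/I)[T]` pulling back to `𝔓` along the reduction map.
[folklore] -/
theorem exists_prime_comap_centreChartReduction :
    ∃ Q : Ideal P, Q.IsPrime ∧ Q.comap (ε.symm.toRingHom.comp (Ideal.Quotient.mk (Ideal.span {ψ (c i)}))) = 𝔓 := by
  set φE := ε.symm.toRingHom.comp (Ideal.Quotient.mk (Ideal.span {ψ (c i)})) with hφE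
  have hsurj : Function.Surjective φE := centreChartReduction_surjective c i ψ ε
  have hker : RingHom.ker φE ≤ 𝔓 := ker_centreChartReduction_le c i w hz ψ ε 𝔓 h𝔓
  refine ⟨𝔓.map φE, Ideal.map_isPrime_of_surjective hsurj hker, ?_⟩
  rw [Ideal.comap_map_of_surjective _ hsurj]
  exact sup_eq_left.mpr hker

/-! ### Units with the Leibniz property are loosely clean -/

/-- **A unit of `L = A_𝔓` with the Leibniz property is loosely clean**: if for some ring map `φ : A → E` to a ring of
characteristic `p`, a prime `Q ⊆ E` over `𝔓` and a derivation `D` of `E` one has `D (φ b) ∉ Q`, then `f'(b/1)` is loosely clean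
(form (2) if no `b - c^p` lies in `𝔪_L`, else form (3) by `stub_leibnizObstruction`). [cite: StacksProject, Tag 07PF] -/
theorem looseCleanForm_unit_of_leibniz {E : Type*} [CommRing E] [CharP E p] (φ : A →+* E) (Q : Ideal E) [Q.IsPrime]
    (hQ : Q.comap φ = 𝔓) (D : Derivation ℤ E E) (b : A) (hb : b ∉ 𝔓) (hDb : D (φ b) ∉ Q)
    {F' : Type*} [CommRing F'] (f' : L →+* F') {Y : F'} (hY : Y = f' (algebraMap A L b)) : LooseCleanForm p f' Y := by
  have hunit : IsUnit (algebraMap A L b) := IsLocalization.map_units L (⟨b, hb⟩ : 𝔓.primeCompl)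
  by_cases h : ∃ c₀ : L, algebraMap A L b - c₀ ^ p ∈ maximalIdeal L
  · obtain ⟨c₀, hc₀⟩ := h
    exact Or.inr (Or.inr ⟨algebraMap A L b, c₀, hY, hc₀, stub_leibnizObstruction φ p hp.out 𝔓 Q hQ D b hDb c₀ hc₀⟩)
  · push Not at h
    exact Or.inr (Or.inl ⟨algebraMap A L b, hunit, hY, h⟩)

/-! ### The permissible monomial form survives -/

include hz hd hrel hnzd hεC hεX h𝔓 in
/-- **The permissible monomial form survives the blowing up** (up to a `p`-th power twist).  If
`Y = f'(ψ(u · ∏_k c_k^{a_k} · ∏_m w_m^{b_m}))` with `u` a unit and some `a_k` or some `b_m` prime to `p` (a loosely clean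
representative which is a monomial in a regular system of parameters `(c, w)` ADAPTED TO THE CENTRE `V(c)`), then `e^p Y` is
loosely clean at `L` for some `e ≠ 0`: in the chart `ψ(∏ c_k^{a_k}) = ψ(cᵢ)^A ∏ u_k^{a_k}` (`A = Σ a_k`); the charged fractions
`u_k ∈ 𝔓` together with `ψ(cᵢ)` and the `ψ(w_m)` are part of a regular system of parameters of `L` (`isRsopPart_chartFamily`),
the uncharged ones are units.  If one of the exponents `A`, `a_k` (charged), `b_m` is prime to `p`: `looseCleanForm_twist_of_isRsopPart`.
Otherwise twist all of them away; the remaining unit `U = ψ(u) ∏_{uncharged} u_k^{a_k}` has `D Ū = a_{k₀} Ū ≠ 0` at the point for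
the Euler derivation `T_{k₀} ∂/∂T_{k₀}` of the exceptional chart `(R/I)[T]`, where `k₀ ≠ i` is an uncharged index with `p ∤ a_{k₀}`
(it exists: `p ∣ A` and `p ∣ a_k` for all charged `k` and for `k = i` would force `p ∣ a_k` for all `k`), so `U` is loosely
clean by the Leibniz obstruction. [cite: Piltant2013, §2 Axiom 2 (ii)] -/
theorem looseCleanForm_centreChart_of_monomial [IsNoetherianRing A] [CharP R p] {F' : Type u} [Field F'] (f' : L →+* F')
    (hf' : Function.Injective f') (a : Fin n → ℕ) (b : Fin l → ℕ) (hab : (∃ k, ¬ p ∣ a k) ∨ (∃ m, ¬ p ∣ b m)) {u : R}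
    (hu : IsUnit u) {Y : F'} (hY : Y = f' (algebraMap A L (ψ (u * (∏ k, c k ^ a k) * ∏ m, w m ^ b m)))) :
    ∃ e : F', e ≠ 0 ∧ LooseCleanForm p f' (e ^ p * Y) := by
  classical
  have hP : 𝔓.IsPrime := ‹_›
  have hui : uA i = 1 := centreChartFrac_self c i ψ uA hrel hnzd
  -- uncharged exponents `a'` (zeroed on the charged fractions) and the unit part `bU`
  set a' : Fin n → ℕ := fun k => if uA k ∈ 𝔓 then 0 else a k with ha'
  set bU : A := ψ u * ∏ k, uA k ^ a' k with hbU
  have hbU𝔓 : bU ∉ 𝔓 := by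
    intro h
    rcases hP.mem_or_mem h with h1 | h1
    · exact hP.ne_top' (Ideal.eq_top_of_isUnit_mem 𝔓 h1 (hu.map ψ))
    · rw [Ideal.IsPrime.prod_mem_iff] at h1
      obtain ⟨k, -, hk⟩ := h1
      by_cases hk𝔓 : uA k ∈ 𝔓
      · rw [ha'] at hk; simp only [hk𝔓, if_true, pow_zero] at hk
        exact hP.ne_top' ((Ideal.eq_top_iff_one 𝔓).mpr hk)
      · rw [ha'] at hk; simp only [hk𝔓, if_false] at hk
        exact hk𝔓 (hP.mem_of_pow_mem _ hk)
  have hbUunit : IsUnit (algebraMap A L bU) := IsLocalization.map_units L (⟨bU, hbU𝔓⟩ : 𝔓.primeCompl)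
  -- the charged set and its enumeration
  set N : Finset (Fin n) := Finset.univ.filter (fun k => uA k ∈ 𝔓) with hN
  let emb : Fin N.card ↪o Fin n := N.orderEmbOfFin rfl
  have hembN : ∀ k, uA (emb k) ∈ 𝔓 := fun k => (Finset.mem_filter.mp (N.orderEmbOfFin_mem rfl k)).2
  have hne : ∀ k, emb k ≠ i := by
    intro k h
    have h1 := hembN k
    rw [h, hui] at h1
    exact hP.ne_top' ((Ideal.eq_top_iff_one 𝔓).mpr h1)
  obtain ⟨jJ, hjJv⟩ : ∃ jJ : Fin N.card → {k : Fin n // k ≠ i}, ∀ k, (jJ k).1 = emb k :=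
    ⟨fun k => ⟨emb k, hne k⟩, fun k => rfl⟩
  have hjJ : Function.Injective jJ := fun k k' h => emb.injective (by rw [← hjJv k, ← hjJv k', h])
  have hrsop : IsRsopPart (chartFamily c i w L ψ uA jJ) :=
    isRsopPart_chartFamily c i w hz hd L ψ uA hnzd ε hεC hεX 𝔓 h𝔓 jJ hjJ (fun k => by rw [hjJv]; exact hembN k)
  -- the exponent vector on the chart family
  set ex : Fin (N.card + l + 1) → ℕ := Fin.cons (∑ k, a k) (Fin.append (fun k => a (emb k)) b) with hex
  -- (i) the product splits: `∏ u_k^{a_k} = ∏ u_k^{a'_k} · ∏_{k ∈ N} u_k^{a_k}`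
  have hsplitA : ∏ k, uA k ^ a k = (∏ k, uA k ^ a' k) * ∏ k ∈ N, uA k ^ a k := by
    rw [hN, Finset.prod_filter, ← Finset.prod_mul_distrib]
    refine Finset.prod_congr rfl fun k _ => ?_
    by_cases hk : uA k ∈ 𝔓
    · simp [ha', hk]
    · simp [ha', hk]
  have hprodN : ∏ k ∈ N, algebraMap A L (uA k) ^ a k = ∏ k : Fin N.card, algebraMap A L (uA (emb k)) ^ a (emb k) := by
    have hmap : (Finset.univ : Finset (Fin N.card)).map emb.toEmbedding = N := by
      apply Finset.coe_injective
      rw [Finset.coe_map, Finset.coe_univ, Set.image_univ]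
      exact N.range_orderEmbOfFin rfl
    rw [← Finset.prod_congr hmap (fun _ _ => rfl), Finset.prod_map]
    rfl
  -- (ii) `ψ(u ∏ c^a ∏ w^b) / 1 = bU/1 · ∏ F_q^{ex_q}` for the chart family `F`
  have hψ : ψ (u * (∏ k, c k ^ a k) * ∏ m, w m ^ b m) =
      ψ (c i) ^ (∑ k, a k) * (bU * ∏ k ∈ N, uA k ^ a k) * ∏ m, ψ (w m) ^ b m := by
    rw [map_mul, map_mul, map_prod, map_prod]
    have h1 : ∏ k, ψ (c k ^ a k) = ∏ k, (ψ (c i) ^ a k * uA k ^ a k) :=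
      Finset.prod_congr rfl fun k _ => by rw [map_pow, hrel k, mul_pow]
    rw [h1, Finset.prod_mul_distrib, Finset.prod_pow_eq_pow_sum, hsplitA, hbU]
    simp only [map_pow]
    ring
  have hprodF : ∏ q, chartFamily c i w L ψ uA jJ q ^ ex q =
      algebraMap A L (ψ (c i)) ^ (∑ k, a k) * (∏ k : Fin N.card, algebraMap A L (uA (emb k)) ^ a (emb k)) *
        ∏ m, algebraMap A L (ψ (w m)) ^ b m := by
    rw [Fin.prod_univ_succ, chartFamily, hex]
    simp only [Fin.cons_zero, Fin.cons_succ]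
    rw [Fin.prod_univ_add]
    simp only [Fin.append_left, Fin.append_right, hjJv]
    ring
  have hY' : Y = f' (algebraMap A L bU * ∏ q, chartFamily c i w L ψ uA jJ q ^ ex q) := by
    rw [hY, hψ, hprodF, ← hprodN]
    simp only [map_mul, map_pow, map_prod]
    ring
  -- (iii) cases: some exponent on the chart family prime to `p`, or all divisible by `p`
  by_cases hcase : ∃ q, ¬ p ∣ ex q
  · exact looseCleanForm_twist_of_isRsopPart p f' hf' hrsop ex hcase hbUunit hY'
  · push Not at hcase
    -- all exponents divisible by `p`: twist them all away
    haveI := hrsop.isRegularLocalRing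
    haveI := isDomain_of_isRegularLocalRing L
    set g : L := ∏ q, chartFamily c i w L ψ uA jJ q ^ (ex q / p) with hg
    have hg0 : g ≠ 0 := Finset.prod_ne_zero_iff.mpr fun q _ => pow_ne_zero _ (hrsop.ne_zero q)
    have hgp : ∏ q, chartFamily c i w L ψ uA jJ q ^ ex q = g ^ p := by
      rw [hg, ← Finset.prod_pow]
      refine Finset.prod_congr rfl fun q _ => ?_
      rw [← pow_mul, Nat.div_mul_cancel (hcase q)]
    have hfg0 : f' g ≠ 0 := (map_ne_zero_iff f' hf').mpr hg0
    refine ⟨(f' g)⁻¹, inv_ne_zero hfg0, ?_⟩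
    have hYe : (f' g)⁻¹ ^ p * Y = f' (algebraMap A L bU) := by
      rw [hY', hgp, map_mul, map_pow, inv_pow]
      field_simp
    -- divisibilities read off `ex`
    have hA : p ∣ ∑ k, a k := by simpa [hex] using hcase 0
    have haN : ∀ k, p ∣ a (emb k) := fun k => by
      simpa [hex] using hcase (Fin.succ (Fin.castAdd l k))
    have hb : ∀ m, p ∣ b m := fun m => by
      simpa [hex] using hcase (Fin.succ (Fin.natAdd N.card m))
    -- an uncharged index `k₀ ≠ i` with `p ∤ a k₀`
    obtain ⟨k₀, hk₀i, hk₀𝔓, hk₀⟩ : ∃ k₀, k₀ ≠ i ∧ uA k₀ ∉ 𝔓 ∧ ¬ p ∣ a k₀ := by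
      have hak : ∃ k, ¬ p ∣ a k := by
        rcases hab with h | ⟨m, hm⟩
        · exact h
        · exact absurd (hb m) hm
      by_contra H
      push Not at H
      have hall : ∀ k, k ≠ i → p ∣ a k := by
        intro k hki
        by_cases hk : uA k ∈ 𝔓
        · have hkN : k ∈ Set.range emb := by
            rw [N.range_orderEmbOfFin rfl]; exact Finset.mem_filter.mpr ⟨Finset.mem_univ _, hk⟩
          obtain ⟨k', rfl⟩ := hkN
          exact haN k'
        · exact H k hki hk
      have hrest : p ∣ ∑ k ∈ Finset.univ.erase i, a k :=
        Finset.dvd_sum fun k hk => hall k (Finset.ne_of_mem_erase hk)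
      have hai : p ∣ a i := by
        rw [← Finset.add_sum_erase Finset.univ a (Finset.mem_univ i)] at hA
        exact (Nat.dvd_add_left hrest).mp hA
      obtain ⟨k, hk⟩ := hak
      by_cases hki : k = i
      · exact hk (hki ▸ hai)
      · exact hk (hall k hki)
    -- the prime of the point on the exceptional chart and the Euler derivation `T_{k₀} ∂/∂T_{k₀}`
    haveI := charP_quotient_span_centre c w hz hd p
    obtain ⟨Q, hQprime, hQ⟩ := exists_prime_comap_centreChartReduction c i w hz ψ ε 𝔓 h𝔓
    haveI := hQprime
    let k₀' : {k : Fin n // k ≠ i} := ⟨k₀, hk₀i⟩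
    obtain ⟨D, hDC, hDX⟩ := MvPolynomial.exists_derivation_C_eq_X_eq (σ := {k : Fin n // k ≠ i}) (T := P)
      (0 : Derivation ℤ (R ⧸ Ideal.span (Set.range c)) P) (fun k => if k = k₀' then X k₀' else 0)
    set φE := ε.symm.toRingHom.comp (Ideal.Quotient.mk (Ideal.span {ψ (c i)})) with hφE
    refine looseCleanForm_unit_of_leibniz 𝔓 L p φE Q hQ D bU hbU𝔓 ?_ f' hYe
    -- `D (b̄U) = a_{k₀} b̄U ∉ Q`
    have hred : φE bU = C (Ideal.Quotient.mk (Ideal.span (Set.range c)) u) * ∏ k, φE (uA k) ^ a' k := by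
      rw [hbU, map_mul, map_prod, hφE, centreChartReduction_map c i ψ ε hεC u]
      simp only [map_pow]
    have hy : ∀ k : Fin n, D (φE (uA k)) = if k = k₀ then φE (uA k) else 0 := by
      intro k
      by_cases hki : k = i
      · have hkk₀ : k ≠ k₀ := fun h => hk₀i (h ▸ hki)
        rw [if_neg hkk₀, hki, hui, map_one]
        exact D.map_one_eq_zero
      · have hXk : φE (uA k) = X ⟨k, hki⟩ := centreChartReduction_frac c i ψ uA ε hεX ⟨k, hki⟩
        rw [hXk, hDX]
        by_cases hkk₀ : k = k₀
        · subst hkk₀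
          rw [if_pos rfl, if_pos rfl]
        · have hne' : (⟨k, hki⟩ : {k : Fin n // k ≠ i}) ≠ k₀' := fun h => hkk₀ (congrArg Subtype.val h)
          rw [if_neg hne', if_neg hkk₀]
    have hx : D (C (Ideal.Quotient.mk (Ideal.span (Set.range c)) u)) = 0 := by
      rw [hDC]
      rfl
    have hDb : D (φE bU) = (a' k₀ : P) * φE bU := by
      rw [hred]
      exact derivation_apply_mul_prod_pow_eq D _ a' k₀ hy hx
    have ha'k₀ : a' k₀ = a k₀ := by simp [ha', hk₀𝔓]
    change D (φE bU) ∉ Q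
    rw [hDb, ha'k₀]
    intro h
    rcases hQprime.mem_or_mem h with h1 | h1
    · have hunit : IsUnit ((a k₀ : ℕ) : P) := by
        rw [← map_natCast C]
        exact (isUnit_natCast_of_not_dvd p hk₀).map C
      exact hQprime.ne_top' (Ideal.eq_top_of_isUnit_mem Q h1 hunit)
    · have h2 : bU ∈ Q.comap φE := Ideal.mem_comap.mpr h1
      rw [hQ] at h2
      exact hbU𝔓 h2

end AbstractChart

end Summit.ResolutionOfSingularities.ResolutionOfSingularities.Theorems.RadicialJung.CleanModels

end
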